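import Summits.QuantumFields.YangMills.Theorems.SwapVirialDeficitSwapRingDeficit
import Summits.QuantumFields.YangMills.Theorems.SwapTwistDeficitPeriodicRingFloorCommBox
import HarnessLib

/-!
# The σ-TWISTED nearly-commuting toron box of the σ-glued ring: `F^S_0 ≤ 300·L⁴·(t₂ + s)²` when the leaders intertwine through the axis swap
# (brick (α2-iii) of LEAD ym-line-sfw-p2 g93's fixed-`L` programme for `TT.twistTrace L β (2L)`; free-hands support of item stmt-QuantumFields-24197
# `SwapVirialDeficit.SwapGluedStiffness`)

The σ-twin of ✓`PeriodicRingFloor.ringDeficit_le_of_commBox`.  In tree-gauge coordinates `(w, (r, g))` with leaders `C_μ = w(−ê_μ, μ)` and `c = g 0`, the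
σ-glued seam bond compares `U_{2L−1} ≈ glue w ≈ ℓ_C` with `g·σ(glue w) ≈ c·ℓ_{C∘σ}·c⁻¹` (`σ(ℓ_C) = ℓ_{C∘σ}`: the letter configuration of `(C₁, C₀, C₂)`, still
comb-gauged), so the flat condition is the σ-TWISTED INTERTWINING `c·C_{σμ}·c⁻¹ = C_μ` (`cC₁c⁻¹ = C₀`, `cC₀c⁻¹ = C₁`, `[c, C₂] = 1`) together with
`[C_μ, C_ν] = 1`; the box asks these up to `s` in Frobenius norm and everything else within `t₂` of its letter.

* §1 `frobNorm_gaugeTransform_sub_le_of_twistedSeam` — `‖(g·U) e − V e‖_F ≤ 4t₂ + s` when `U ≈ ℓ'`, `V ≈ ℓ`, `g ≈ c`, `‖cℓ' − ℓc‖ ≤ s`;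
* §2 ★★ `swapRingDeficit_le_of_commBox` — `F^S_0(glue w ∷ r, g) ≤ 300·L⁴·(t₂+s)²` (✓`swapRingDeficit_eq_sums`, ✓`wilsonAction_le_of_commBox`,
  ✓`wilsonAction_configPerm`, ✓`kinetic_le_of_dist`).

HONEST FRAMING: fixed-lattice Frobenius-norm bookkeeping; no floor ∕ ceiling yet; ⟨24197⟩, ⟨24194⟩ and every rung stay OPEN; the Yang–Mills mass gap is NOT
proved; no summit is proved by a line.  THEOREMS ONLY (0 `def`, 0 `sorry`), standard axioms.  Width seat ym-line-sfw-p2-w3 g61 (cell ym-idea-1, free hands),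
`--supports stmt-QuantumFields-24197`.  References: [cite: Luscher1983, §2]; [cite: tHooft1979]; [cite: GonzalezarroyoAltes1988].
-/

set_option autoImplicit false

noncomputable section

open MeasureTheory
open scoped BigOperators
open Literature.MathematicalPhysics.QuantumFieldTheory hiding SU2
open Literature.MathematicalPhysics.QuantumLattice

namespace Summit.QuantumFields.YangMills.Theorems.SwapVirialDeficit.SwapRing

open Summit.QuantumFields.YangMills.Theorems.FemtoTransferGap
open Summit.QuantumFields.YangMills.Theorems.FemtoTransferGap.TT
open Summit.QuantumFields.YangMills.Theorems.VirialFluxGap.RingDeficit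
open Summit.QuantumFields.YangMills.Theorems.SwapTwistDeficit.PeriodicRingFloor

variable {L : ℕ} [NeZero L]

/-! ## §1 The σ-glued seam on the box -/

omit [NeZero L] in
/-- **The glued seam moves a letter configuration onto its partner**: if every `g x` is `t₂`-close to `c = g 0`, `c` intertwines the letters up to `s`
(`‖c·ℓ'_e − ℓ_e·c‖_F ≤ s`), `U e` is `t₂`-close to `ℓ'_e` and `V e` is `t₂`-close to `ℓ_e`, then `‖(g·U) e − V e‖_F ≤ 4t₂ + s`
(`g_xUg_y⁻¹ ≈ cUc⁻¹ ≈ cℓ'c⁻¹ ≈ ℓ ≈ V`; ✓`frobNorm_gaugeTransform_sub_le_of_commSeam` is the case `ℓ' = ℓ`, `U = V`). [cite: Luscher1983, §2] -/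
theorem frobNorm_gaugeTransform_sub_le_of_twistedSeam {t₂ s : ℝ} {g : Site 3 L → SU2} {U V : GaugeConfig 3 L SU2} (ℓ ℓ' : Edge 3 L → SU2)
    (hg : ∀ x, frobNorm ((((g 0)⁻¹ * g x : SU2) : Matrix (Fin 2) (Fin 2) ℂ) - 1) ≤ t₂)
    (hcomm : ∀ e, frobNorm (((g 0 * ℓ' e : SU2) : Matrix (Fin 2) (Fin 2) ℂ) - ((ℓ e * g 0 : SU2) : Matrix (Fin 2) (Fin 2) ℂ)) ≤ s)
    (hU : ∀ e, frobNorm ((U e : Matrix (Fin 2) (Fin 2) ℂ) - (ℓ' e : Matrix (Fin 2) (Fin 2) ℂ)) ≤ t₂)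
    (hV : ∀ e, frobNorm ((V e : Matrix (Fin 2) (Fin 2) ℂ) - (ℓ e : Matrix (Fin 2) (Fin 2) ℂ)) ≤ t₂) (e : Edge 3 L) :
    frobNorm (((gaugeTransform g U e : SU2) : Matrix (Fin 2) (Fin 2) ℂ) - (V e : Matrix (Fin 2) (Fin 2) ℂ)) ≤ 4 * t₂ + s := by
  set c : SU2 := g 0 with hc
  have hgx : ∀ x, frobNorm ((g x : Matrix (Fin 2) (Fin 2) ℂ) - (c : Matrix (Fin 2) (Fin 2) ℂ)) ≤ t₂ := fun x => by
    rw [← frobNorm_inv_mul_sub_one]; exact hg x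
  have h1 := frobNorm_sandwich_sub_sandwich_le (g e.1) (g (e.1.shift e.2)) c (U e)
  have h2 : frobNorm (((c * U e * c⁻¹ : SU2) : Matrix (Fin 2) (Fin 2) ℂ) - ((c * ℓ' e * c⁻¹ : SU2) : Matrix (Fin 2) (Fin 2) ℂ)) ≤ t₂ := by
    rw [TwoLattice.ConstTube.frobNorm_conj_sub_conj]; exact hU e
  have h3 : frobNorm (((c * ℓ' e * c⁻¹ : SU2) : Matrix (Fin 2) (Fin 2) ℂ) - (ℓ e : Matrix (Fin 2) (Fin 2) ℂ)) ≤ s := by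
    rw [frobNorm_sub_eq_mul_inv, ← frobNorm_sub_eq_mul_inv (c * ℓ' e * c⁻¹) (ℓ e)]
    have e1 : frobNorm (((c * ℓ' e * c⁻¹ : SU2) : Matrix (Fin 2) (Fin 2) ℂ) - (ℓ e : Matrix (Fin 2) (Fin 2) ℂ)) =
        frobNorm (((c * ℓ' e : SU2) : Matrix (Fin 2) (Fin 2) ℂ) - ((ℓ e * c : SU2) : Matrix (Fin 2) (Fin 2) ℂ)) := by
      rw [frobNorm_sub_eq_mul_inv, frobNorm_sub_eq_mul_inv (c * ℓ' e) (ℓ e * c), mul_inv_rev]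
      congr 2; group
    rw [e1]; exact hcomm e
  have h4 : frobNorm ((ℓ e : Matrix (Fin 2) (Fin 2) ℂ) - (V e : Matrix (Fin 2) (Fin 2) ℂ)) ≤ t₂ := by rw [frobNorm_sub_comm]; exact hV e
  calc frobNorm (((gaugeTransform g U e : SU2) : Matrix (Fin 2) (Fin 2) ℂ) - (V e : Matrix (Fin 2) (Fin 2) ℂ))
      ≤ frobNorm (((g e.1 * U e * (g (e.1.shift e.2))⁻¹ : SU2) : Matrix (Fin 2) (Fin 2) ℂ) -
            ((c * U e * c⁻¹ : SU2) : Matrix (Fin 2) (Fin 2) ℂ)) +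
          frobNorm (((c * U e * c⁻¹ : SU2) : Matrix (Fin 2) (Fin 2) ℂ) - (V e : Matrix (Fin 2) (Fin 2) ℂ)) := frobNorm_sub_le _ _ _
    _ ≤ (t₂ + t₂) + (t₂ + (s + t₂)) := by
        refine add_le_add (h1.trans (add_le_add (hgx _) (hgx _))) ?_
        refine (frobNorm_sub_le _ _ _).trans (add_le_add h2 ?_)
        exact (frobNorm_sub_le _ _ _).trans (add_le_add h3 h4)
    _ = 4 * t₂ + s := by ring

/-! ## §2 The σ-glued deficit on the σ-twisted nearly-commuting box -/

/-- ★★ **THE σ-GLUED RING DEFICIT IS `≤ 300·L⁴·(t₂ + s)²` ON THE σ-TWISTED NEARLY-COMMUTING BOX.**  Tree-gauge coordinates `(w, (r, g))`, ring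
history `(glue w ∷ r, g)`, leaders `C μ = w(−ê_μ, μ)` and `c = g 0`; hypotheses: `‖C_μC_ν − C_νC_μ‖_F ≤ s` (all pairs) and the σ-TWISTED
intertwining `‖c·C_{σμ} − C_μ·c‖_F ≤ s` (`σ = swap 0 1`: `cC₁ ≈ C₀c`, `cC₀ ≈ C₁c`, `cC₂ ≈ C₂c`), every other off-tree link of slice `0` within `t₂` of
its letter, the slices `1…2L−1` within `t₂` of `glue w`, the seam field within `t₂` of `g 0`; `0 ≤ t₂, s`.  Through ✓`swapRingDeficit_eq_sums`:
kinetic bonds `≤ 6L³t₂²`, Wilson actions `≤ 3L³(8t₂+s)²/2` (✓`wilsonAction_le_of_commBox`; `S(g·σU₀) = S(U₀)` by ✓`wilsonAction_configPerm`), and the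
σ-glued seam bond `≤ 3L³(8(t₂+s))²/2`: `σ(glue w)` is `t₂`-close to the SWAPPED letter configuration `ℓ' = ℓ_{C∘σ}` (✓`configPerm_apply`), which `c`
conjugates back onto `ℓ` up to `s` (`frobNorm_gaugeTransform_sub_le_of_twistedSeam`). [cite: Luscher1983, §2] [cite: tHooft1979] -/
theorem swapRingDeficit_le_of_commBox {t₂ s : ℝ} (ht₂ : 0 ≤ t₂) (hs : 0 ≤ s)
    (w : OffIdx L → SU2) (r : Fin (2 * L - 1) → GaugeConfig 3 L SU2) (g : Site 3 L → SU2)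
    (hCC : ∀ μ ν : Fin 3,
      frobNorm (((w ⟨(Pi.single μ (-1 : ZMod L), μ), leader_not_treeEdge μ⟩ * w ⟨(Pi.single ν (-1 : ZMod L), ν), leader_not_treeEdge ν⟩ : SU2) :
          Matrix (Fin 2) (Fin 2) ℂ) -
        ((w ⟨(Pi.single ν (-1 : ZMod L), ν), leader_not_treeEdge ν⟩ * w ⟨(Pi.single μ (-1 : ZMod L), μ), leader_not_treeEdge μ⟩ : SU2) :
          Matrix (Fin 2) (Fin 2) ℂ)) ≤ s)
    (hσ : ∀ μ : Fin 3,
      frobNorm (((g 0 * w ⟨(Pi.single (Equiv.swap (0 : Fin 3) 1 μ) (-1 : ZMod L), Equiv.swap (0 : Fin 3) 1 μ),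
          leader_not_treeEdge (Equiv.swap (0 : Fin 3) 1 μ)⟩ : SU2) : Matrix (Fin 2) (Fin 2) ℂ) -
        ((w ⟨(Pi.single μ (-1 : ZMod L), μ), leader_not_treeEdge μ⟩ * g 0 : SU2) : Matrix (Fin 2) (Fin 2) ℂ)) ≤ s)
    (hw : ∀ i : OffIdx L, frobNorm ((((if i.1.1 i.1.2 = -1 then w ⟨(Pi.single i.1.2 (-1 : ZMod L), i.1.2), leader_not_treeEdge i.1.2⟩
        else 1)⁻¹ * w i : SU2) : Matrix (Fin 2) (Fin 2) ℂ) - 1) ≤ t₂)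
    (hr : ∀ (j : Fin (2 * L - 1)) (e : Edge 3 L), frobNorm ((((glue w e)⁻¹ * r j e : SU2) : Matrix (Fin 2) (Fin 2) ℂ) - 1) ≤ t₂)
    (hg : ∀ x, frobNorm ((((g 0)⁻¹ * g x : SU2) : Matrix (Fin 2) (Fin 2) ℂ) - 1) ≤ t₂) :
    swapRingDeficit L (fun _ => false) ((Fin.cons (glue w) r : Fin (2 * L - 1 + 1) → GaugeConfig 3 L SU2), g) ≤
      300 * (L : ℝ) ^ 4 * (t₂ + s) ^ 2 := by
  -- abbreviations
  set σ : Equiv.Perm (Fin 3) := Equiv.swap (0 : Fin 3) 1 with hσdef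
  set C : Fin 3 → SU2 := fun μ => w ⟨(Pi.single μ (-1 : ZMod L), μ), leader_not_treeEdge μ⟩ with hCdef
  set ℓ : Edge 3 L → SU2 := fun e => if e.1 e.2 = -1 then C e.2 else 1 with hℓ
  set ℓ' : Edge 3 L → SU2 := fun e => if e.1 e.2 = -1 then C (σ e.2) else 1 with hℓ'
  set P : Fin (2 * L - 1 + 1) → GaugeConfig 3 L SU2 := Fin.cons (glue w) r with hP
  have hL1 : (1 : ℝ) ≤ L := by exact_mod_cast NeZero.one_le
  have hL0 : (0 : ℝ) ≤ (L : ℝ) ^ 3 := by positivity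
  have hts : 0 ≤ t₂ + s := add_nonneg ht₂ hs
  have hCC' : ∀ μ ν, frobNorm (((C μ * C ν : SU2) : Matrix (Fin 2) (Fin 2) ℂ) - ((C ν * C μ : SU2) : Matrix (Fin 2) (Fin 2) ℂ)) ≤ s := hCC
  -- the seam value intertwines ℓ' and ℓ up to `s`
  have hcℓ : ∀ e, frobNorm (((g 0 * ℓ' e : SU2) : Matrix (Fin 2) (Fin 2) ℂ) - ((ℓ e * g 0 : SU2) : Matrix (Fin 2) (Fin 2) ℂ)) ≤ s := by
    intro e; simp only [hℓ, hℓ']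
    split_ifs
    · exact hσ _
    · rw [mul_one, one_mul, sub_self, frobNorm_zero]; exact hs
  -- slice 0 is `t₂`-close to the letters, linkwise
  have h0ℓ : ∀ e : Edge 3 L, frobNorm (((glue w e : SU2) : Matrix (Fin 2) (Fin 2) ℂ) - (ℓ e : Matrix (Fin 2) (Fin 2) ℂ)) ≤ t₂ := by
    intro e
    by_cases he : treeEdge e = true
    · have hne := apply_ne_neg_one_of_treeEdge he
      rw [glue_apply_of_tree w he]
      simp only [hℓ, if_neg hne, sub_self, frobNorm_zero]
      exact ht₂
    · rw [glue_apply_of_not_tree w he, ← frobNorm_inv_mul_sub_one]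
      exact hw ⟨e, he⟩
  -- the swapped slice 0 is `t₂`-close to the swapped letters
  have h0ℓ' : ∀ e : Edge 3 L, frobNorm (((configPerm σ (glue w) e : SU2) : Matrix (Fin 2) (Fin 2) ℂ) - (ℓ' e : Matrix (Fin 2) (Fin 2) ℂ)) ≤ t₂ := by
    intro e
    rw [configPerm_apply]
    have key : ℓ (sitePerm σ.symm e.1, σ.symm e.2) = ℓ' e := by
      simp only [hℓ, hℓ', sitePerm_apply, hσdef, Equiv.symm_swap, Equiv.swap_apply_self]
    rw [← key]; exact h0ℓ _
  -- every slice is `t₂`-close to slice 0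
  have hP0 : ∀ (i : Fin (2 * L - 1 + 1)) (e : Edge 3 L),
      frobNorm ((P i e : Matrix (Fin 2) (Fin 2) ℂ) - ((glue w e : SU2) : Matrix (Fin 2) (Fin 2) ℂ)) ≤ t₂ := by
    intro i e
    refine Fin.cases ?_ (fun j => ?_) i
    · simp only [hP, Fin.cons_zero, sub_self, frobNorm_zero]; exact ht₂
    · simp only [hP, Fin.cons_succ]
      rw [← frobNorm_inv_mul_sub_one]; exact hr j e
  -- every slice is in the nearly-commuting box of radii `(s, 2t₂)`
  have hPℓ : ∀ (i : Fin (2 * L - 1 + 1)) (e : Edge 3 L),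
      frobNorm ((((ℓ e)⁻¹ * P i e : SU2) : Matrix (Fin 2) (Fin 2) ℂ) - 1) ≤ 2 * t₂ := by
    intro i e
    rw [frobNorm_inv_mul_sub_one]
    exact (frobNorm_sub_le _ _ _).trans (by linarith [hP0 i e, h0ℓ e])
  have hS : ∀ i : Fin (2 * L - 1 + 1), wilsonAction su2Rep (P i) ≤ 96 * (L : ℝ) ^ 3 * (t₂ + s) ^ 2 := by
    intro i
    have h := wilsonAction_le_of_commBox (P i) C hs hCC' (t₂ := 2 * t₂) (fun e => hPℓ i e)
    have hb : (4 * (2 * t₂) + s) ^ 2 / 2 ≤ 32 * (t₂ + s) ^ 2 := by nlinarith [mul_nonneg ht₂ hs, sq_nonneg s, sq_nonneg t₂]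
    nlinarith [hb]
  have hSg : wilsonAction su2Rep (gaugeTransform g (configPerm σ (P 0))) ≤ 96 * (L : ℝ) ^ 3 * (t₂ + s) ^ 2 := by
    rw [wilsonAction_gaugeTransform, wilsonAction_configPerm su2Rep continuous_su2Rep]; exact hS 0
  -- kinetic bonds
  have hkin : ∀ i : Fin (2 * L - 1),
      6 * (L : ℝ) ^ 3 - timeCoupling su2Rep (P i.castSucc) (P i.succ) ≤ 6 * (L : ℝ) ^ 3 * (t₂ + s) ^ 2 := by
    intro i
    have hd : ∀ e, frobNorm ((P i.castSucc e : Matrix (Fin 2) (Fin 2) ℂ) - (P i.succ e : Matrix (Fin 2) (Fin 2) ℂ)) ≤ 2 * t₂ :=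
      fun e => (frobNorm_sub_le _ ((glue w e : SU2) : Matrix (Fin 2) (Fin 2) ℂ) _).trans (by
        rw [frobNorm_sub_comm ((glue w e : SU2) : Matrix (Fin 2) (Fin 2) ℂ)]
        linarith [hP0 i.castSucc e, hP0 i.succ e])
    have h := kinetic_le_of_dist (by positivity) hd
    nlinarith [h, mul_nonneg ht₂ hs, sq_nonneg s]
  -- the σ-glued seam bond
  have hseam : 6 * (L : ℝ) ^ 3 - timeCoupling su2Rep (P (Fin.last (2 * L - 1))) (gaugeTransform g (configPerm σ (P 0))) ≤
      3 * (L : ℝ) ^ 3 * ((8 * (t₂ + s)) ^ 2 / 2) := by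
    have hP00 : P 0 = glue w := by simp only [hP, Fin.cons_zero]
    have hlast : ∀ e, frobNorm ((P (Fin.last (2 * L - 1)) e : Matrix (Fin 2) (Fin 2) ℂ) - (ℓ e : Matrix (Fin 2) (Fin 2) ℂ)) ≤ 2 * t₂ :=
      fun e => (frobNorm_sub_le _ ((glue w e : SU2) : Matrix (Fin 2) (Fin 2) ℂ) _).trans (by linarith [hP0 (Fin.last (2 * L - 1)) e, h0ℓ e])
    have hσ0 : ∀ e, frobNorm (((configPerm σ (P 0) e : SU2) : Matrix (Fin 2) (Fin 2) ℂ) - (ℓ' e : Matrix (Fin 2) (Fin 2) ℂ)) ≤ 2 * t₂ :=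
      fun e => by rw [hP00]; linarith [h0ℓ' e]
    have hd : ∀ e, frobNorm ((P (Fin.last (2 * L - 1)) e : Matrix (Fin 2) (Fin 2) ℂ) -
        ((gaugeTransform g (configPerm σ (P 0)) e : SU2) : Matrix (Fin 2) (Fin 2) ℂ)) ≤ 8 * (t₂ + s) := by
      intro e
      have h2 := frobNorm_gaugeTransform_sub_le_of_twistedSeam (t₂ := 2 * t₂) ℓ ℓ' (fun x => (hg x).trans (by linarith)) hcℓ hσ0 hlast e
      rw [frobNorm_sub_comm] at h2
      linarith [h2]
    exact kinetic_le_of_dist (by positivity) hd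
  -- assemble through `swapRingDeficit_eq_sums`
  rw [swapRingDeficit_eq_sums, twist3_false]
  dsimp only
  have hcast : ((2 * L - 1 : ℕ) : ℝ) = 2 * (L : ℝ) - 1 := by
    have : 1 ≤ L := NeZero.one_le
    rw [Nat.cast_sub (by omega), Nat.cast_mul]; norm_num
  have hA : ∑ i : Fin (2 * L - 1), (6 * (L : ℝ) ^ 3 - timeCoupling su2Rep (P i.castSucc) (P i.succ)) ≤
      (2 * (L : ℝ) - 1) * (6 * (L : ℝ) ^ 3 * (t₂ + s) ^ 2) := by
    calc ∑ i : Fin (2 * L - 1), (6 * (L : ℝ) ^ 3 - timeCoupling su2Rep (P i.castSucc) (P i.succ))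
        ≤ ∑ _i : Fin (2 * L - 1), 6 * (L : ℝ) ^ 3 * (t₂ + s) ^ 2 := Finset.sum_le_sum fun i _ => hkin i
      _ = (2 * (L : ℝ) - 1) * (6 * (L : ℝ) ^ 3 * (t₂ + s) ^ 2) := by
          rw [Finset.sum_const, Finset.card_univ, Fintype.card_fin, nsmul_eq_mul, hcast]
  have hB : ∑ i : Fin (2 * L - 1), (1 / 2 : ℝ) * (wilsonAction su2Rep (P i.castSucc) + wilsonAction su2Rep (P i.succ)) ≤
      (2 * (L : ℝ) - 1) * (96 * (L : ℝ) ^ 3 * (t₂ + s) ^ 2) := by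
    calc ∑ i : Fin (2 * L - 1), (1 / 2 : ℝ) * (wilsonAction su2Rep (P i.castSucc) + wilsonAction su2Rep (P i.succ))
        ≤ ∑ _i : Fin (2 * L - 1), 96 * (L : ℝ) ^ 3 * (t₂ + s) ^ 2 :=
          Finset.sum_le_sum fun i _ => by linarith [hS i.castSucc, hS i.succ]
      _ = (2 * (L : ℝ) - 1) * (96 * (L : ℝ) ^ 3 * (t₂ + s) ^ 2) := by
          rw [Finset.sum_const, Finset.card_univ, Fintype.card_fin, nsmul_eq_mul, hcast]
  have hD : (1 / 2 : ℝ) * (wilsonAction su2Rep (P (Fin.last (2 * L - 1))) + wilsonAction su2Rep (gaugeTransform g (configPerm σ (P 0)))) ≤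
      96 * (L : ℝ) ^ 3 * (t₂ + s) ^ 2 := by linarith [hS (Fin.last (2 * L - 1)), hSg]
  have ht0 : 0 ≤ (t₂ + s) ^ 2 := sq_nonneg _
  have hmono : (L : ℝ) ^ 3 * (t₂ + s) ^ 2 ≤ (L : ℝ) ^ 4 * (t₂ + s) ^ 2 := by
    have h := mul_nonneg (mul_nonneg hL0 (sub_nonneg.2 hL1)) ht0
    nlinarith [h]
  nlinarith [hA, hB, hD, hseam, hmono, mul_nonneg hL0 ht0]

end Summit.QuantumFields.YangMills.Theorems.SwapVirialDeficit.SwapRing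

end
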